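import Literature.Analysis.FluidPDE.AxisymmetricL3OffAxis
import Literature.Analysis.FluidPDE.SereginEpsilonRegularityHolds
import Literature.Analysis.FluidPDE.CKNTheoremB
import Literature.Analysis.FluidPDE.SuitableWeakProofs
import Summits.NavierStokesRegularity.NavierStokesRegularity.Theorems.CertifiedBlowupCertifiedBlowupAxisymBlowupBlowupSet
import HarnessLib

/-!
# The blow-up set of a witness of the crux `CertifiedBlowupAxisymBlowup` is `ℋ¹`-null

Theorems file landed `--supports stmt-NavierStokesRegularity-0727`, line `compact-amplification`
(continuation lead c3, wave 1). For a witness of the crux — a maximal smooth solution `(u, p)` of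
finite lifespan `T` of the unforced Navier–Stokes system (`ν > 0`), Leray–Hopf on `[0, T]` from its
rapidly decaying axisymmetric datum — the blow-up set `Σ = {x₀ | ¬ IsBoundedNearTop u T x₀}` (a
nonempty compact subset of the axis, c2's `blowupSet_nonempty_compact_on_axis`) is `μH[1]`-null:
Caffarelli–Kohn–Nirenberg's Theorem B at the top time, from PROVED tree theorems only.
`exists_isBoundedNearTop_of_dissipation_le` is backward ε-regularity at a top point `(T, x₀)`, ANY
`x₀` (the template `axisymmetricL3_boundedNearTop_offAxis_of_seregin` — rescaling about `(T, x₀)`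
and `seregin2014_thm14_holds` — with the packing bound replaced by a smallness hypothesis);
`frequently_lt_setLIntegral_of_not_isBoundedNearTop` is the resulting positive upper density of the
dissipation at blow-up points; `parabolicHausdorff_image_top_eq_zero` combines the Vitali covering
estimate `parabolicHausdorff_one_le_of_frequently` with the vanishing dissipation tails
`AxisymmetricL3Hyp.exists_time_tail_lt` into `𝒫¹({T} × Σ) = 0`; the registered
`hausdorffMeasure_one_blowupSet_eq_zero` follows by `IsParabolicNull.hausdorffMeasure_eq_zero_holds`
and the isometry `x ↦ (T, x)`. No new definitions, no named-fact hypotheses, no `sorry`.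

## References

* L. Caffarelli, R. Kohn, L. Nirenberg, Comm. Pure Appl. Math. 35 (1982), Theorem B and §6.
  [CaffarelliKohnNirenberg1982]
* G. Seregin, *Lecture Notes on Regularity Theory for the Navier–Stokes Equations*, World
  Scientific 2014, Ch. 6 §6.1 Thm. 1.4. [Seregin2014]
* G. Seregin, V. Šverák, Comm. PDE 34 (2009) = arXiv:0804.1803, §3. [SereginSverak2009]
-/

-- the summit and its single problem share the name (D-0017 nested layout)
set_option linter.dupNamespace false

noncomputable section

open MeasureTheory Set Function Filter Topology Metric
open scoped ENNReal NNReal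

namespace Summit.NavierStokesRegularity.NavierStokesRegularity.Theorems.CertifiedBlowupAxisymBlowup.CompactAmplification

open Literature.Analysis.FluidPDE

/-- **Backward ε-regularity at a point `(T, x₀)` of the final time, any `x₀`.** There is a
universal `ε > 0` such that, under `AxisymmetricL3Hyp ν T u p`, for every `x₀` and every `R > 0`
with `R (2 + 1/√ν) ≤ √T / 2`: if `(ν R r)⁻¹ ∫∫_{(T - (Rr)²/ν, T) × B(x₀, Rr)} |∇u|² ≤ ε` for all
`0 < r < 1`, then `u` is bounded on a backward parabolic neighbourhood of `(T, x₀)` (proof of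
`axisymmetricL3_boundedNearTop_offAxis_of_seregin` verbatim — rescaling by `α = R/ν`, `β = R²/ν`
about `(T, x₀)` to the unit-viscosity system in `Q(0, 1)`, Seregin's criterion, transport back —
the packing bound replaced by the hypothesis). [cite: Seregin2014, Ch. 6 §6.1 Thm. 1.4] -/
theorem exists_isBoundedNearTop_of_dissipation_le :
    ∃ ε : ℝ, 0 < ε ∧ ∀ {ν T : ℝ} {u : ℝ → EuclideanSpace ℝ (Fin 3) → EuclideanSpace ℝ (Fin 3)}
      {p : ℝ → EuclideanSpace ℝ (Fin 3) → ℝ}, AxisymmetricL3Hyp ν T u p →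
      ∀ (x₀ : EuclideanSpace ℝ (Fin 3)) {R : ℝ}, 0 < R →
      R * (2 + (Real.sqrt ν)⁻¹) ≤ Real.sqrt T / 2 →
      (∀ r ∈ Ioo (0 : ℝ) 1, (ENNReal.ofReal (ν * (R * r)))⁻¹ *
          ∫⁻ z in Ioo (T - (R * r) ^ 2 / ν) T ×ˢ ball x₀ (R * r),
            ENNReal.ofReal (frobeniusNormSq (fderiv ℝ (u z.1) z.2)) ≤ ENNReal.ofReal ε) →
      IsBoundedNearTop u T x₀ := by
  obtain ⟨ε, hε, hcrit⟩ := seregin2014_thm14_holds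
  refine ⟨ε / 2, half_pos hε, fun {ν T u p} H x₀ R hRpos hRκ hle => ?_⟩
  have hν := H.viscosity_pos
  have hT := H.time_pos
  set κ : ℝ := 2 + (Real.sqrt ν)⁻¹ with hκ
  have hκpos : 0 < κ := by positivity
  set ρ : ℝ := R * κ with hρ
  have hρT : ρ ^ 2 ≤ T := by
    have h2 : ρ ^ 2 ≤ (Real.sqrt T / 2) ^ 2 := pow_le_pow_left₀ (by positivity) hRκ 2
    rw [div_pow, Real.sq_sqrt hT.le] at h2; linarith
  set α : ℝ := R / ν with hα
  set β : ℝ := R ^ 2 / ν with hβdef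
  have hαpos : 0 < α := by positivity
  have hβpos : 0 < β := by positivity
  have hβeq : β = α * R := by rw [hβdef, hα]; field_simp
  have hβρ : β ≤ ρ ^ 2 := by
    have h1 : β = (R * (Real.sqrt ν)⁻¹) ^ 2 := by
      rw [hβdef, mul_pow, inv_pow, Real.sq_sqrt hν.le, div_eq_mul_inv]
    rw [h1, hρ]
    have h2 : (Real.sqrt ν)⁻¹ ≤ κ := by rw [hκ]; linarith
    exact pow_le_pow_left₀ (by positivity) (mul_le_mul_of_nonneg_left h2 hRpos.le) 2
  have hRρ : R ≤ ρ :=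
    le_mul_of_one_le_right hRpos.le (by rw [hκ]; linarith [inv_nonneg.2 (Real.sqrt_nonneg ν)])
  have hβT : β ≤ T := hβρ.trans hρT
  obtain ⟨q, hsuit, hqae, -⟩ := H.exists_gauged_pressure
  have hcylslab : parabolicCylinder ρ ((T : ℝ), x₀) ⊆ Ioo 0 T ×ˢ univ := by
    intro z hz
    rw [mem_parabolicCylinder] at hz
    exact ⟨⟨by nlinarith [hz.1.1], hz.1.2⟩, mem_univ _⟩
  have hνcyl : ∀ r : ℝ, 0 < r → r ≤ 1 →
      Ioo (T - (R * r) ^ 2 / ν) T ×ˢ ball x₀ (R * r) ⊆ parabolicCylinder ρ ((T : ℝ), x₀) := by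
    intro r hr hr1
    have hRr : R * r ≤ R := mul_le_of_le_one_right hRpos.le hr1
    have h1 : (R * r) ^ 2 / ν ≤ ρ ^ 2 := by
      refine le_trans ?_ hβρ
      rw [hβdef]
      exact div_le_div_of_nonneg_right (pow_le_pow_left₀ (by positivity) hRr 2) hν.le
    rintro ⟨t, x⟩ ⟨ht, hx⟩
    rw [mem_parabolicCylinder]
    refine ⟨⟨by linarith [ht.1], ht.2⟩, ?_⟩
    rw [mem_ball] at hx
    exact lt_of_lt_of_le hx (hRr.trans hRρ)
  set PO : TopologicalSpace.Opens (ℝ × EuclideanSpace ℝ (Fin 3)) :=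
    ⟨Ioo (T - β) T ×ˢ ball x₀ R, isOpen_Ioo.prod isOpen_ball⟩ with hPO
  have hPOcyl : (PO : Set (ℝ × EuclideanSpace ℝ (Fin 3))) ⊆ parabolicCylinder ρ ((T : ℝ), x₀) := by
    have := hνcyl 1 one_pos le_rfl
    rwa [mul_one] at this
  have hPOslab : (PO : Set (ℝ × EuclideanSpace ℝ (Fin 3))) ⊆ Ioo 0 T ×ˢ univ := hPOcyl.trans hcylslab
  have hpre1 : stPreimage β R T x₀ PO = parabolicCylinderOpens 1 0 := by
    apply TopologicalSpace.Opens.ext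
    rw [coe_stPreimage]
    have h := stAffine_preimage_cylinder_eq_parabolicCylinder hν hRpos T x₀ R
    rwa [div_self hRpos.ne'] at h
  -- the rescaled pair and gradient on `Q(0, 1) = Φ⁻¹(PO)`
  have hsuit1 : IsSuitableWeakSolutionOn (parabolicCylinderOpens 1 0) 1 0
      (α • stPull β R T x₀ u) (α ^ 2 • stPull β R T x₀ q) := by
    have h0 := (hsuit PO hPOslab).stRescale hαpos hRpos hβeq T x₀
    have hvisc : α * ν / R = 1 := by rw [hα, div_mul_cancel₀ R hν.ne', div_self hRpos.ne']
    have hforce : ((α ^ 2 * R) • stPull β R T x₀ (0 : ℝ → EuclideanSpace ℝ (Fin 3) → EuclideanSpace ℝ (Fin 3))) = 0 := by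
      funext s y; simp [stPull]
    rwa [hvisc, hforce, hpre1] at h0
  have hGu : HasWeakSpatialGradientOn PO u fun t x => fderiv ℝ (u t) x :=
    hasWeakSpatialGradientOn_of_contDiffOn isOpen_Ioo hPOslab
      (H.classical_Ioo.smooth_velocity.of_le (by norm_cast))
  have hGv : HasWeakSpatialGradientOn (parabolicCylinderOpens 1 0)
      (α • stPull β R T x₀ u) ((α * R) • stPull β R T x₀ fun t x => fderiv ℝ (u t) x) := by
    rw [← hpre1]
    exact hGu.stRescale α hβpos hRpos T x₀
  -- the dissipation of the rescaled pair on `Q(0, r)`: `E(r) = (ν R r)⁻¹ D(R r)`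
  have hEr : ∀ r : ℝ, 0 < r →
      ∫⁻ z in parabolicCylinder r (0 : ℝ × EuclideanSpace ℝ (Fin 3)), ENNReal.ofReal (frobeniusNormSq
          (((α * R) • stPull β R T x₀ fun t x => fderiv ℝ (u t) x) z.1 z.2)) =
        ENNReal.ofReal ((α * R) ^ 2) * ENNReal.ofReal (β * R ^ 3)⁻¹ *
          ∫⁻ z in Ioo (T - (R * r) ^ 2 / ν) T ×ˢ ball x₀ (R * r),
            ENNReal.ofReal (frobeniusNormSq (fderiv ℝ (u z.1) z.2)) := by
    intro r hr
    have hpre : parabolicCylinder r (0 : ℝ × EuclideanSpace ℝ (Fin 3)) =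
        stAffine β R T x₀ ⁻¹' (Ioo (T - (R * r) ^ 2 / ν) T ×ˢ ball x₀ (R * r)) := by
      rw [hβdef, stAffine_preimage_cylinder_eq_parabolicCylinder hν hRpos T x₀ (R * r),
        mul_div_cancel_left₀ r hRpos.ne']
      rfl
    rw [hpre, setLIntegral_frobeniusNormSq_stRescale hβpos hRpos T x₀ (α * R),
      finrank_euclideanSpace_fin]
  have hcknE : ∀ r ∈ Ioo (0 : ℝ) 1,
      cknE r (0 : ℝ × EuclideanSpace ℝ (Fin 3)) ((α * R) • stPull β R T x₀ fun t x => fderiv ℝ (u t) x) =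
        (ENNReal.ofReal (ν * (R * r)))⁻¹ *
          ∫⁻ z in Ioo (T - (R * r) ^ 2 / ν) T ×ˢ ball x₀ (R * r),
            ENNReal.ofReal (frobeniusNormSq (fderiv ℝ (u z.1) z.2)) := by
    intro r hr
    have hr0 : 0 < r := hr.1
    have key : (ENNReal.ofReal r)⁻¹ *
        (ENNReal.ofReal ((α * R) ^ 2) * ENNReal.ofReal (β * R ^ 3)⁻¹) =
          (ENNReal.ofReal (ν * (R * r)))⁻¹ := by
      rw [← ENNReal.ofReal_inv_of_pos hr0, ← ENNReal.ofReal_mul (sq_nonneg _),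
        ← ENNReal.ofReal_mul (inv_nonneg.2 hr0.le),
        ← ENNReal.ofReal_inv_of_pos (by positivity : (0 : ℝ) < ν * (R * r))]
      congr 1
      rw [hα, hβdef]
      field_simp
    unfold cknE
    rw [hEr r hr0, ← mul_assoc, key]
  -- the rescaled pair in the class `IsSuitableWeakSolutionInBall 1 0`
  have hball : IsSuitableWeakSolutionInBall 1 0 (α • stPull β R T x₀ u)
      (α ^ 2 • stPull β R T x₀ q) := by
    refine ⟨hsuit1, ?_, ⟨_, hGv, ?_⟩, ?_⟩
    · -- energy class from the energy inequality
      set CE : ℝ≥0∞ := ENNReal.ofReal (2 * VectorCalculus.kineticEnergy (u 0)) with hCE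
      have hphys : ∀ᵐ t ∂(volume.restrict (Ioo (T + β * (-1)) (T + β * 0))),
          ∫⁻ x in ball x₀ R, ‖u t x‖ₑ ^ 2 ≤ CE := by
        refine (ae_restrict_mem measurableSet_Ioo).mono fun t ht => ?_
        have htI : t ∈ Ico 0 T := ⟨by nlinarith [ht.1], by simpa using ht.2⟩
        exact (setLIntegral_le_lintegral _ _).trans (H.eEnergy_le htI)
      have h2 := ae_sliced_setLIntegral_ball_stRescale hβpos hRpos T x₀ x₀ R (-1) 0
        (fun t x => ‖u t x‖ₑ ^ 2) hphys
      rw [finrank_euclideanSpace_fin, sub_self, smul_zero, div_self hRpos.ne'] at h2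
      set C₁ : ℝ≥0∞ := ‖α‖ₑ ^ 2 * (ENNReal.ofReal (R ^ 3)⁻¹ * CE) with hC₁
      have hC₁top : C₁ ≠ ∞ :=
        ENNReal.mul_ne_top (by simp) (ENNReal.mul_ne_top ENNReal.ofReal_ne_top ENNReal.ofReal_ne_top)
      refine ⟨C₁.toNNReal, ?_⟩
      rw [ENNReal.coe_toNNReal hC₁top]
      have hset : Ioo ((0 : ℝ × EuclideanSpace ℝ (Fin 3)).1 - 1 ^ 2) (0 : ℝ × EuclideanSpace ℝ (Fin 3)).1 =
          Ioo (-1 : ℝ) 0 := by simp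
      rw [hset]
      filter_upwards [h2] with s hs
      have e : ∀ y : EuclideanSpace ℝ (Fin 3), ‖(α • stPull β R T x₀ u) s y‖ₑ ^ 2 =
          ‖α‖ₑ ^ 2 * ‖u (T + β * s) (x₀ + R • y)‖ₑ ^ 2 := by
        intro y
        rw [smul_stPull_apply, enorm_smul, mul_pow]
      simp only [e]
      rw [lintegral_const_mul' _ _ (by simp)]
      exact mul_le_mul' le_rfl hs
    · -- `∫_{Q(0,1)} |∇v|² < ∞`
      rw [hEr 1 one_pos]
      refine ENNReal.mul_lt_top (ENNReal.mul_lt_top ENNReal.ofReal_lt_top ENNReal.ofReal_lt_top) ?_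
      refine lt_of_le_of_lt (lintegral_mono_set ?_) H.lintegral_slab_frobeniusNormSq_fderiv_lt_top
      rw [mul_one]
      exact prod_mono (Ioo_subset_Ioo_left (by linarith)) (subset_univ _)
    · -- `π ∈ L^{3/2}(Q(0,1))`
      refine ⟨hsuit1.distributional.2.2.1.aestronglyMeasurable, ?_⟩
      have h32 : ((3 : ℝ≥0∞) / 2).toReal = 3 / 2 := by rw [ENNReal.toReal_div]; norm_num
      have h32top : (3 : ℝ≥0∞) / 2 ≠ ∞ := (ENNReal.div_lt_top (by simp) (by simp)).ne
      rw [eLpNorm_eq_lintegral_rpow_enorm_toReal (by norm_num) h32top, h32]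
      refine ENNReal.rpow_lt_top_of_nonneg (by positivity) (ne_of_lt ?_)
      have hQ1 : parabolicCylinder 1 (0 : ℝ × EuclideanSpace ℝ (Fin 3)) =
          stAffine β R T x₀ ⁻¹' (PO : Set (ℝ × EuclideanSpace ℝ (Fin 3))) := by rw [← coe_stPreimage, hpre1]; rfl
      rw [hQ1]
      show ∫⁻ z in stAffine β R T x₀ ⁻¹' (PO : Set (ℝ × EuclideanSpace ℝ (Fin 3))),
          ‖(α ^ 2 • stPull β R T x₀ q) z.1 z.2‖ₑ ^ (3 / 2 : ℝ) < ∞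
      rw [setLIntegral_enorm_rpow_stRescale hβpos hRpos T x₀ (α ^ 2) q _ (by norm_num)]
      refine ENNReal.mul_lt_top (ENNReal.mul_lt_top
        (ENNReal.rpow_lt_top_of_nonneg (by norm_num) enorm_ne_top) ENNReal.ofReal_lt_top) ?_
      exact lt_of_le_of_lt (lintegral_mono_set hPOcyl)
        (H.lintegral_cylinder_gauged_pressure_lt_top hqae hρT x₀)
  -- `sup_{0<r<1} E(r) ≤ ε/2 < ε`: the criterion applies; transport back to `u`
  have hsmall : (⨆ r ∈ Ioo (0 : ℝ) 1,
      cknE r (0 : ℝ × EuclideanSpace ℝ (Fin 3)) ((α * R) • stPull β R T x₀ fun t x => fderiv ℝ (u t) x)) <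
        ENNReal.ofReal ε := by
    refine lt_of_le_of_lt (iSup₂_le fun r hr => (hcknE r hr).trans_le (hle r hr)) ?_
    exact (ENNReal.ofReal_lt_ofReal_iff hε).2 (by linarith)
  obtain ⟨ϱ, hϱ, hbd⟩ := hcrit _ _ hball ⟨_, hGv, hsmall⟩
  exact H.isBoundedNearTop_of_eLpNorm_rescaled_lt_top x₀ hαpos hβpos hRpos hϱ.1 hbd

section Witness

variable {ν T : ℝ} {u : ℝ → EuclideanSpace ℝ (Fin 3) → EuclideanSpace ℝ (Fin 3)}
  {p : ℝ → EuclideanSpace ℝ (Fin 3) → ℝ}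

/-- **Positive upper density of the dissipation at a blow-up point.** If backward ε-regularity at
top points holds with constant `ε` (`exists_isBoundedNearTop_of_dissipation_le`) and `x₀` is a
blow-up point, then arbitrarily small centred cylinders `Q*_r(T, x₀)` carry slab dissipation
`> (ε ν / m) r`, `m = max 1 (1/√ν)`: at every admissible scale `R` some `ν`-cylinder
`(T - ρ²/ν, T) × B(x₀, ρ) ⊆ Q*_{mρ}(T, x₀) ∩ (0, T) × ℝ³`, `ρ < R`, has `(ν ρ)⁻¹ ∫∫ |∇u|² > ε`.
[cite: CaffarelliKohnNirenberg1982, §6 (proof of Theorem B)] -/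
theorem frequently_lt_setLIntegral_of_not_isBoundedNearTop (H : AxisymmetricL3Hyp ν T u p)
    {ε : ℝ} (hε : 0 < ε)
    (hA : ∀ (x₀ : EuclideanSpace ℝ (Fin 3)) {R : ℝ}, 0 < R →
      R * (2 + (Real.sqrt ν)⁻¹) ≤ Real.sqrt T / 2 →
      (∀ r ∈ Ioo (0 : ℝ) 1, (ENNReal.ofReal (ν * (R * r)))⁻¹ *
          ∫⁻ z in Ioo (T - (R * r) ^ 2 / ν) T ×ˢ ball x₀ (R * r),
            ENNReal.ofReal (frobeniusNormSq (fderiv ℝ (u z.1) z.2)) ≤ ENNReal.ofReal ε) →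
      IsBoundedNearTop u T x₀)
    {x₀ : EuclideanSpace ℝ (Fin 3)} (hx₀ : ¬ IsBoundedNearTop u T x₀) :
    ∃ᶠ r in 𝓝[>] (0 : ℝ),
      ENNReal.ofReal (ε * ν / max 1 (Real.sqrt ν)⁻¹) * ENNReal.ofReal r <
        ∫⁻ w in parabolicCylinderCentered r ((T : ℝ), x₀),
          (Ioo 0 T ×ˢ (univ : Set (EuclideanSpace ℝ (Fin 3)))).indicator
            (fun w => ENNReal.ofReal (frobeniusNormSq (fderiv ℝ (u w.1) w.2))) w := by
  have hν := H.viscosity_pos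
  have hT := H.time_pos
  set κ : ℝ := 2 + (Real.sqrt ν)⁻¹ with hκ
  have hκpos : 0 < κ := by positivity
  set m : ℝ := max 1 (Real.sqrt ν)⁻¹ with hm
  have hmpos : 0 < m := by positivity
  have hm0 : m ≠ 0 := hmpos.ne'
  have hmν : ν⁻¹ ≤ m ^ 2 := by
    have h2 := pow_le_pow_left₀ (by positivity) (le_max_right 1 (Real.sqrt ν)⁻¹) 2
    rwa [inv_pow, Real.sq_sqrt hν.le] at h2
  rw [(nhdsGT_basis (0 : ℝ)).frequently_iff]
  intro b hb
  -- an admissible scale `R` with `m R ≤ b`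
  set R : ℝ := min (b / m) (Real.sqrt T / (2 * κ)) with hR
  have hRpos : 0 < R := lt_min (by positivity) (by positivity)
  have hRκ : R * κ ≤ Real.sqrt T / 2 :=
    calc R * κ ≤ Real.sqrt T / (2 * κ) * κ := mul_le_mul_of_nonneg_right (min_le_right _ _) hκpos.le
      _ = Real.sqrt T / 2 := by field_simp
  have hRb : m * R ≤ b :=
    calc m * R ≤ m * (b / m) := mul_le_mul_of_nonneg_left (min_le_left _ _) hmpos.le
      _ = b := by field_simp
  have hRνT : R ^ 2 / ν ≤ T := by
    have h1 : (Real.sqrt ν)⁻¹ ≤ κ := by rw [hκ]; linarith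
    have h2 := pow_le_pow_left₀ (by positivity) ((mul_le_mul_of_nonneg_left h1 hRpos.le).trans hRκ) 2
    rw [mul_pow, inv_pow, Real.sq_sqrt hν.le, div_pow, Real.sq_sqrt hT.le] at h2
    rw [div_eq_mul_inv]; linarith
  -- ε-regularity fails at the blow-up point: a `ν`-cylinder `ϱ < R` of large dissipation
  have hnot := mt (hA x₀ hRpos hRκ) hx₀
  push Not at hnot
  obtain ⟨r, hr, hlt⟩ := hnot
  have hϱpos : 0 < R * r := mul_pos hRpos hr.1
  have hϱR : R * r < R := mul_lt_of_lt_one_right hRpos hr.2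
  set ϱ : ℝ := R * r with hϱ
  have hc0 : ENNReal.ofReal (ν * ϱ) ≠ 0 := (ENNReal.ofReal_pos.2 (by positivity)).ne'
  refine ⟨m * ϱ, ⟨by positivity, (mul_lt_mul_of_pos_left hϱR hmpos).trans_le hRb⟩, ?_⟩
  -- the `ν`-cylinder lies in the slab and in `Q*_{mϱ}(T, x₀)`
  have hsub : Ioo (T - ϱ ^ 2 / ν) T ×ˢ ball x₀ ϱ ⊆
      (Ioo 0 T ×ˢ univ) ∩ parabolicCylinderCentered (m * ϱ) ((T : ℝ), x₀) := by
    have h1 : ϱ ^ 2 / ν ≤ T :=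
      (div_le_div_of_nonneg_right (pow_le_pow_left₀ hϱpos.le hϱR.le 2) hν.le).trans hRνT
    have h2 : ϱ ^ 2 / ν ≤ (m * ϱ) ^ 2 :=
      calc ϱ ^ 2 / ν = ϱ ^ 2 * ν⁻¹ := div_eq_mul_inv _ _
        _ ≤ ϱ ^ 2 * m ^ 2 := mul_le_mul_of_nonneg_left hmν (sq_nonneg _)
        _ = (m * ϱ) ^ 2 := by ring
    have h3 : ϱ ≤ m * ϱ := le_mul_of_one_le_left hϱpos.le (le_max_left _ _)
    rintro ⟨t, x⟩ ⟨ht, hx⟩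
    refine ⟨⟨⟨by linarith [ht.1], ht.2⟩, mem_univ _⟩, ?_⟩
    rw [mem_parabolicCylinderCentered]
    refine ⟨⟨by linarith [ht.1], by linarith [ht.2, sq_nonneg (m * ϱ)]⟩, ?_⟩
    rw [mem_ball] at hx
    exact lt_of_lt_of_le hx h3
  calc ENNReal.ofReal (ε * ν / m) * ENNReal.ofReal (m * ϱ)
      = ENNReal.ofReal (ν * ϱ) * ENNReal.ofReal ε := by
        rw [← ENNReal.ofReal_mul (by positivity), ← ENNReal.ofReal_mul (by positivity)]
        congr 1
        field_simp
    _ < ENNReal.ofReal (ν * ϱ) * ((ENNReal.ofReal (ν * ϱ))⁻¹ *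
          ∫⁻ z in Ioo (T - ϱ ^ 2 / ν) T ×ˢ ball x₀ ϱ,
            ENNReal.ofReal (frobeniusNormSq (fderiv ℝ (u z.1) z.2))) :=
        ENNReal.mul_lt_mul_right hc0 ENNReal.ofReal_ne_top hlt
    _ = ∫⁻ z in Ioo (T - ϱ ^ 2 / ν) T ×ˢ ball x₀ ϱ,
          ENNReal.ofReal (frobeniusNormSq (fderiv ℝ (u z.1) z.2)) := by
        rw [← mul_assoc, ENNReal.mul_inv_cancel hc0 ENNReal.ofReal_ne_top, one_mul]
    _ ≤ ∫⁻ w in (Ioo 0 T ×ˢ univ) ∩ parabolicCylinderCentered (m * ϱ) ((T : ℝ), x₀),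
          ENNReal.ofReal (frobeniusNormSq (fderiv ℝ (u w.1) w.2)) := lintegral_mono_set hsub
    _ = ∫⁻ w in parabolicCylinderCentered (m * ϱ) ((T : ℝ), x₀),
          (Ioo 0 T ×ˢ (univ : Set (EuclideanSpace ℝ (Fin 3)))).indicator
            (fun w => ENNReal.ofReal (frobeniusNormSq (fderiv ℝ (u w.1) w.2))) w := by
        rw [lintegral_indicator (measurableSet_Ioo.prod MeasurableSet.univ),
          Measure.restrict_restrict (measurableSet_Ioo.prod MeasurableSet.univ)]

/-- **The covering step of CKN's Theorem B at the top time.** If every point `(T, x₀)`, `x₀ ∈ B`,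
carries arbitrarily small centred cylinders `Q*_r(T, x₀)` with slab dissipation `> l r`
(`0 < l < ∞`), then `𝒫¹({T} × B) = 0`: for `δ > 0` some tail `∫∫_{(T-τ, T) × ℝ³} |∇u|² < δ`
(`AxisymmetricL3Hyp.exists_time_tail_lt`), and the Vitali covering estimate
`parabolicHausdorff_one_le_of_frequently` in `V = (T - τ, T + τ) × ℝ³ ⊇ {T} × B` gives
`𝒫¹({T} × B) ≤ 5 l⁻¹ ∫∫_V 𝟙_{(0,T) × ℝ³} |∇u|² ≤ 5 l⁻¹ δ → 0`. [cite: CaffarelliKohnNirenberg1982, Theorem B and §6] -/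
theorem parabolicHausdorff_image_top_eq_zero (H : AxisymmetricL3Hyp ν T u p)
    {B : Set (EuclideanSpace ℝ (Fin 3))} {l : ℝ≥0∞} (hl0 : l ≠ 0) (hlt : l ≠ ∞)
    (hB : ∀ x₀ ∈ B, ∃ᶠ r in 𝓝[>] (0 : ℝ), l * ENNReal.ofReal r <
        ∫⁻ w in parabolicCylinderCentered r ((T : ℝ), x₀),
          (Ioo 0 T ×ˢ (univ : Set (EuclideanSpace ℝ (Fin 3)))).indicator
            (fun w => ENNReal.ofReal (frobeniusNormSq (fderiv ℝ (u w.1) w.2))) w) :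
    parabolicHausdorff 1 ((fun x : EuclideanSpace ℝ (Fin 3) => ((T : ℝ), x)) '' B) = 0 := by
  have h5 : (5 : ℝ≥0∞) * l⁻¹ ≠ ∞ := ENNReal.mul_ne_top (by simp) (ENNReal.inv_ne_top.2 hl0)
  -- the bound at level `δ`
  have key : ∀ δ : ℝ≥0∞, 0 < δ →
      parabolicHausdorff 1 ((fun x : EuclideanSpace ℝ (Fin 3) => ((T : ℝ), x)) '' B) ≤
        5 * l⁻¹ * δ := by
    intro δ hδ
    obtain ⟨τ, hτ, -, hDτ⟩ := H.exists_time_tail_lt hδ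
    have hYV : (fun x : EuclideanSpace ℝ (Fin 3) => ((T : ℝ), x)) '' B ⊆
        Ioo (T - τ) (T + τ) ×ˢ univ := by
      rintro _ ⟨x, -, rfl⟩
      exact ⟨⟨by linarith, by linarith⟩, mem_univ _⟩
    refine (parabolicHausdorff_one_le_of_frequently
      (F := (Ioo 0 T ×ˢ univ).indicator
        fun w => ENNReal.ofReal (frobeniusNormSq (fderiv ℝ (u w.1) w.2)))
      (isOpen_Ioo.prod isOpen_univ) hYV hl0 hlt ?_).trans (mul_le_mul' le_rfl (le_trans ?_ hDτ.le))
    · rintro _ ⟨x, hx, rfl⟩; exact hB x hx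
    · rw [lintegral_indicator (measurableSet_Ioo.prod MeasurableSet.univ),
        Measure.restrict_restrict (measurableSet_Ioo.prod MeasurableSet.univ)]
      refine lintegral_mono_set ?_
      rintro ⟨t, x⟩ ⟨⟨ht, -⟩, ht', -⟩
      exact ⟨⟨ht'.1, ht.2⟩, mem_univ _⟩
  -- let `δ → 0⁺`
  have hlim : Tendsto (fun δ : ℝ≥0∞ => 5 * l⁻¹ * δ) (𝓝[>] (0 : ℝ≥0∞)) (𝓝 0) := by
    have h := ENNReal.Tendsto.const_mul (a := 5 * l⁻¹) (tendsto_id (x := 𝓝 (0 : ℝ≥0∞))) (Or.inr h5)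
    rw [mul_zero] at h
    exact h.mono_left nhdsWithin_le_nhds
  refine le_antisymm (ge_of_tendsto hlim ?_) zero_le
  filter_upwards [self_mem_nhdsWithin] with δ hδ using key δ hδ

/-- **From `𝒫¹({T} × B) = 0` to `μH[1](B) = 0`**: `𝒫¹`-null sets of `ℝ × ℝ³` are `μH[1]`-null
(`IsParabolicNull.hausdorffMeasure_eq_zero_holds`), and `x ↦ (T, x)` is an isometry of `ℝ³` onto
`{T} × ℝ³ ⊆ ℝ × ℝ³` (sup distance on the product), so it preserves `μH[1]`
(`Isometry.hausdorffMeasure_image`). [cite: CaffarelliKohnNirenberg1982, §2 after (2.6)] -/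
theorem hausdorffMeasure_eq_zero_of_parabolicHausdorff_image_eq_zero
    {B : Set (EuclideanSpace ℝ (Fin 3))}
    (h : parabolicHausdorff 1 ((fun x : EuclideanSpace ℝ (Fin 3) => ((T : ℝ), x)) '' B) = 0) :
    μH[1] B = 0 := by
  have hiso : Isometry (fun x : EuclideanSpace ℝ (Fin 3) => ((T : ℝ), x)) := fun x y => by
    simp [Prod.edist_eq]
  rw [← hiso.hausdorffMeasure_image (Or.inl zero_le_one) B]
  exact IsParabolicNull.hausdorffMeasure_eq_zero_holds one_pos h

end Witness

/-- **Caffarelli–Kohn–Nirenberg at the first singular time** (registered stub of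
stmt-NavierStokesRegularity-0727): for a maximal Leray–Hopf classical solution `(u, p)` of finite
lifespan `T` (`ν > 0`) from a rapidly decaying axisymmetric datum, the blow-up set
`Σ = {x₀ | ¬ IsBoundedNearTop u T x₀}` (points at which `u` is unbounded on every backward parabolic
neighbourhood of `(T, x₀)`) has `μH[1] Σ = 0` (maximality is not used); with c2's
`blowupSet_nonempty_compact_on_axis`, `Σ` is a nonempty compact `ℋ¹`-null subset of the axis.
[cite: CaffarelliKohnNirenberg1982, Theorem B and §6] -/
theorem hausdorffMeasure_one_blowupSet_eq_zero : ∀ {ν T : ℝ} {u : ℝ → EuclideanSpace ℝ (Fin 3) → EuclideanSpace ℝ (Fin 3)} {p : ℝ → EuclideanSpace ℝ (Fin 3) → ℝ}, 0 < ν → 0 < T → IsMaximalSmoothSolution ν 0 u p T → IsLerayHopfOn T ν 0 (u 0) u → HasRapidSpatialDecay (u 0) → IsAxisymmetric (u 0) → MeasureTheory.Measure.hausdorffMeasure 1 {x₀ : EuclideanSpace ℝ (Fin 3) | ¬ IsBoundedNearTop u T x₀} = 0 := by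
  intro ν T u p hν hT hmax hLH hdec haxi
  have H := axisymmetricL3Hyp_of_lerayHopf_classical hν hT hmax.1 hLH hdec haxi
  obtain ⟨ε, hε, hA⟩ := exists_isBoundedNearTop_of_dissipation_le
  exact hausdorffMeasure_eq_zero_of_parabolicHausdorff_image_eq_zero
    (parabolicHausdorff_image_top_eq_zero H (ENNReal.ofReal_pos.2 (by positivity)).ne'
      ENNReal.ofReal_ne_top fun x₀ hx₀ =>
      frequently_lt_setLIntegral_of_not_isBoundedNearTop H hε (hA H) hx₀)

end Summit.NavierStokesRegularity.NavierStokesRegularity.Theorems.CertifiedBlowupAxisymBlowup.CompactAmplification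

end
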